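import Literature.NumberTheory.EllipticCurves.ModularCurve
import Literature.NumberTheory.EllipticCurves.QuadraticTwist
import Literature.NumberTheory.EllipticCurves.GlobalMinimalModel
import Literature.NumberTheory.DiophantineGeometry.Conductor
import Mathlib.NumberTheory.Padics.PadicVal.Basic
import HarnessLib
import HarnessLib.Audit.Tags

/-!
# Candidate E-an-33 `CommutingOrbitDiscrDirection p` — the DISCRIMINANT DIRECTION LAW on commuting
# optimal ramified twists — cell `bsd-f2-manin`, `@[conjecture]` leaf (NOTHING asserted; definition only;
# proved edges in `TwistOrbitManinNearInvariance.lean`).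

HONEST FRAMING. LENS = analytic (planner `bsd-f2-manin-an` g5, MEMO-an §44; decl VERBATIM from HOME `run/shared/lean/pub/bsd-f2-manin/an/Sec24Core-g5b.lean` sha16 a6e0e51924ef88c2 (= Sec24Core-g5 9ed34f9b51be5933 + §27, lines 1183–1477 `section NearInvariance`; farm rc 0 · 0 errors · 0 warnings · 0 sorries; MEMO-an §44; CANDIDATES rows E-an-32/33),
source line 1434). Informal law: «on a COMMUTING optimal `p*`-pair at an odd prime `p` with `p² ∣ N = N′`
(`W`, `W′` globally minimal, `D`, `D′` lattice-optimal at the conductor levels, `u • (W ⊗ p*) = W′`), if the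
modular degree goes UP (`deg′ = p·deg`) then the minimal discriminant goes UP (`v_pΔ_min′ = v_pΔ_min + 6`)»
— NO Manin constant in it. By the PROVED `commutingOrbitManinValEq_iff_discrDirection` (sibling file) it is
EQUIVALENT, for odd prime `p`, to the leaf `CommutingOrbitManinValEq p` (imc's orbit Manin `p`-invariance on
commuting pairs), hence to E-imc-7R for all `d`; unconditionally `|v_p c′ − v_p c| ≤ 1` there
(`commutingOrbitManinValNear_holds`). PLACEMENT (declared by -an, concurred by refuter-2 v7): = Edixhoven 1991
§4 «only case 2 occurs», asserted there («one can prove») for `p > 7` and potentially SUPERSINGULAR reduction,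
explicitly OPEN there for potentially ordinary reduction; open here at every odd `p`; with the tree fact
`edixhoven_not_dvd_maninConstant_of_not_potentiallyGoodOrdinary` it holds at `p > 7` off the (G)-ordinary
shape (§28, planner sketch). BC5: (Δ_deg, Δv_pΔ) ∈ {(+1,+6), (−1,−6)} on 667 706/667 706 commuting odd-`p`
same-conductor rows of TWISTCENSUS2 v1 43352cbe215eb58a (HOME `an/direction-test-g5.txt` f3ef423e7342fbe2).
REF1 R-an-19 (refuter-1 g3 §R31, 2026-08-27T21:54Z): SURVIVES at odd primes but MISSTATED as first typed —
the UNGUARDED schema `CommutingOrbitDiscrDirection` is FALSE at `p = 1` (`W ⊗ 1 ≅ W`, `v₁ ≡ 0`; kernel-checked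
`commutingOrbitDiscrDirection_one_false_of`, HOME `ref1-C39-an-g5c.lean`) and an unintended multi-prime statement
at composite `p`; REPAIR C′ = the guard `p.Prime → p ≠ 2 →` (as in E-an-32). The gate's append-only rule for landed
definitions (`theorems.append-only`: deprecate-and-add, never mutate) puts C′ under the NEW name
`CommutingOrbitDiscrDirectionR` (below; the decl of record from now on); the unguarded def stays, SUPERSEDED, because
the landed theorem `commutingOrbitManinValEq_iff_discrDirection` (which carries `p.Prime`, `p ≠ 2` itself and is
therefore unaffected) references it; `commutingOrbitDiscrDirectionR_iff` / `commutingOrbitManinValEq_iff_discrDirectionR`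
(sibling file) bridge the two. BC7 CLEAN; non-vacuity in the ordered form (deg′ = p·deg): 99a1→99c1 (p = 3: deg
4→12, v₃Δ 3→9, III→III*), 200e1→200a1 (p = 5), 242a1→242b1 (p = 11). Beyond-print theorem: NO (a conjecture).
-/

noncomputable section

open scoped MatrixGroups ModularForm

open CongruenceSubgroup WeierstrassCurve
  Literature.NumberTheory.DiophantineGeometry
  Literature.NumberTheory.EllipticCurves
  Literature.NumberTheory.EllipticCurves.ModularForms

namespace Summit.BirchSwinnertonDyer.Rank1Residual.ManinAdditive

/-- (SUPERSEDED SCHEMA — unguarded in `p`, false at `p = 1` (refuter-1 §R31); the decl of record is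
`CommutingOrbitDiscrDirectionR` below, `= p.Prime → p ≠ 2 →` this; kept under the gate's append-only rule.)
**THE OPEN NODE IN LOCAL FORM — DISCRIMINANT DIRECTION LAW (typed, E-an-33):** on a commuting optimal
`p*`-pair, if the modular degree goes UP (`deg′ = p·deg`) then the minimal discriminant goes UP
(`v_pΔ′ = v_pΔ + 6`; at `p ≥ 5`: the degree-larger optimal twist is the STARRED Kodaira member).  By
`commutingOrbitManinValEq_iff_discrDirection` (in `TwistOrbitManinNearInvariance.lean`) this is EQUIVALENT to E-imc-1b on commuting pairs
(`CommutingOrbitManinValEq p`).  BC5: (Δ_deg, Δv_pΔ) ∈ {(+1,+6), (−1,−6)} on 667 706/667 706 commuting odd-`p`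
same-conductor rows of TWISTCENSUS2 v1 (the DIRECTION LAW, HOME/an/direction-test-g5.txt).  PLACEMENT: = «only case 2
occurs» of Edixhoven §4, asserted there («one can prove») for `p > 7` and POTENTIALLY SUPERSINGULAR reduction (parity of
the inseparability degree vs the `μₙ`-action) and explicitly OPEN there for potentially ordinary reduction; open here at
every odd `p`. [cite: EdixhovenManin1991, §4 (p. 13, last paragraph)] -/
@[conjecture] def CommutingOrbitDiscrDirection (p : ℕ) : Prop :=
  ∀ (W W' : WeierstrassCurve ℚ) [W.IsElliptic] [W.IsGloballyMinimal] [W'.IsElliptic]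
    [W'.IsGloballyMinimal] [NeZero (W.conductorNorm ℤ)] [NeZero (W'.conductorNorm ℤ)]
    (u : VariableChange ℚ) (D : ModularParametrizationData W (W.conductorNorm ℤ))
    (D' : ModularParametrizationData W' (W'.conductorNorm ℤ)),
    (∀ z ∈ D.L.lattice, ∃ w ∈ periodLattice D.f, z = D.c * w) →
    (∀ z ∈ D'.L.lattice, ∃ w ∈ periodLattice D'.f, z = D'.c * w) →
    p ^ 2 ∣ W.conductorNorm ℤ → W'.conductorNorm ℤ = W.conductorNorm ℤ →
    u • W.quadraticTwist ((((-1 : ℤ) ^ (p / 2) * p : ℤ)) : ℚ) = W' →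
    D'.modularDegree = p * D.modularDegree →
    padicValInt p W'.minimalDiscriminantInt = padicValInt p W.minimalDiscriminantInt + 6

/-- **Candidate E-an-33 (REPAIRED FORM C′, decl of record) `CommutingOrbitDiscrDirectionR p` — the
DISCRIMINANT DIRECTION LAW on commuting optimal ramified twists at an ODD PRIME `p`:** for `p` prime, `p ≠ 2`,
on a commuting optimal `p*`-pair (`W`, `W′` globally minimal, `D`, `D′` lattice-optimal at the conductor levels,
`p² ∣ N = N′`, `u • (W ⊗ p*) = W′`), if the modular degree goes UP (`deg′ = p·deg`) then the minimal
discriminant goes UP (`v_pΔ_min′ = v_pΔ_min + 6`). Verbatim the planner's body (HOME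
`an/Sec24Core-g5b.lean` a6e0e51924ef88c2 :1434) behind refuter-1's guard `p.Prime → p ≠ 2 →` (§R31 C′; the
planner's sibling E-an-32 `CommutingOrbitManinValNear` is guarded the same way). For odd prime `p` it is
EQUIVALENT to `CommutingOrbitManinValEq p` (`commutingOrbitManinValEq_iff_discrDirectionR`, sibling file
`TwistOrbitManinNearInvariance.lean`) and to the superseded unguarded schema (`commutingOrbitDiscrDirectionR_iff`).
PLACEMENT: = Edixhoven 1991 §4 «only case 2 occurs» (asserted for `p > 7`, potentially supersingular; open for
potentially ordinary); open here at every odd prime. REF1 §R31: SURVIVES (C′), BC7 CLEAN.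
[cite: EdixhovenManin1991, §4 (p. 13, last paragraph)] -/
@[conjecture] def CommutingOrbitDiscrDirectionR (p : ℕ) : Prop :=
  p.Prime → p ≠ 2 →
  ∀ (W W' : WeierstrassCurve ℚ) [W.IsElliptic] [W.IsGloballyMinimal] [W'.IsElliptic]
    [W'.IsGloballyMinimal] [NeZero (W.conductorNorm ℤ)] [NeZero (W'.conductorNorm ℤ)]
    (u : VariableChange ℚ) (D : ModularParametrizationData W (W.conductorNorm ℤ))
    (D' : ModularParametrizationData W' (W'.conductorNorm ℤ)),
    (∀ z ∈ D.L.lattice, ∃ w ∈ periodLattice D.f, z = D.c * w) →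
    (∀ z ∈ D'.L.lattice, ∃ w ∈ periodLattice D'.f, z = D'.c * w) →
    p ^ 2 ∣ W.conductorNorm ℤ → W'.conductorNorm ℤ = W.conductorNorm ℤ →
    u • W.quadraticTwist ((((-1 : ℤ) ^ (p / 2) * p : ℤ)) : ℚ) = W' →
    D'.modularDegree = p * D.modularDegree →
    padicValInt p W'.minimalDiscriminantInt = padicValInt p W.minimalDiscriminantInt + 6

end Summit.BirchSwinnertonDyer.Rank1Residual.ManinAdditive

end
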